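import Summits.BirchSwinnertonDyer.BirchSwinnertonDyer.Theorems.ByReductionTypeAtTwoRankOneAtTwoOffBigImageOddLocalEngineUniformSupply
import HarnessLib

/-!
# Crux U1 `KolyvaginBoundedDefectAtTwo` (stmt-BirchSwinnertonDyer-28083), LINE 17 `regular_core_rigidity` v3,
# stub S1b `stub_nearCoreExistenceAtTwo` — (N5) THE VALUE ENGINE, part 1: Step B with PRESCRIBED VALUES on a
# `τ`-STABLE SPAN (phantom-tolerant): joint surjectivity, the value algebra, McCallum's Galois element (K-side)

Width seat `bsd-line-krr2-p2` g14 (ONE READER on S1b); `--supports stmt-BirchSwinnertonDyer-28083` (helper). THEOREMS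
ONLY; nothing here proves S1b, U1, a rung or BSD. BSD is NOT proved.

## Why (reader reports S1-READER-g12/g13, item (N5))

The walk of S1b (Mazur–Rubin Cor. 2.7.3-shaped Selmer-rank lowering at `p = 2` through REGULAR Kolyvagin primes)
must prescribe, at each new prime `λ`, the localisation of the WHOLE current modified Selmer group `S`, a
`ℤ/2^M[Gal(K/ℚ)]`-module of arbitrary type (`±`-eigenclasses of both signs, free pairs, non-split extensions). The
crux-23716 engine port (`OffBigImageOddLocalAtTwo.Engine.exists_regular_kolyvaginPrime_of_heegner`) prescribes exact
local ORDERS for a family that is `τ`-stable UNDER A PERMUTATION and independent — a `−1`-eigenclass of order `> 2`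
fits only as the dependent pair `{z, −z}`, and order prescriptions on a free pair `{c, τc}` do not force a full cut
(S1-READER-g13-addendum, "engine interface note"). The value engine (this file = Step B; the sequel
`…RegularValueEngineAtTwo` = ℚ-side packaging and the end-to-end Čebotarev statement) removes all three limits:
* the family `cs` is any lift of a basis of the RESTRICTED span `res(S) ⊆ Hom(Γ_{K(E[2^M])}, E[2^M])` — exponents and
  independence are asked of the restrictions only (`he`, `hind`), so classes meeting the inflation kernel
  `H¹(K(E[2^M])/K, E[2^M])` (Lawson–Wuthrich; killed by `2` on the habitat, tree
  `inflationDefect_one_of_hasSurjectiveModNGaloisRep`) are allowed ("phantom-tolerant");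
* `τ`-stability is asked of the span, as an integer matrix `Tm` (`σ_* c_i ≡ ∑_j Tm i j • c_j` on `Γ_{K(E[2^M])}`);
* the prescription is a CHARACTER `α : ι → ℤ` (`2^M ∣ 2^{e_i} α_i`): the evaluation of `c_i` at `(τρ)²` becomes
  `α_i • P + (∑_j Tm i j α_j) • AP`, where `A` is the regular involution and `E[2^M] = ℤP ⊕ ℤ·AP` — i.e. EVERY
  `Gal(K/ℚ)`-equivariant homomorphism `res(S) → E[2^M]` is realised (the offsets `[c_i, h²]` are absorbed because
  `Hom(res S, E[2^M])` with the twisted conjugation action is an induced `C₂`-module, `E[2^M]` being `ℤ/2^M[A]`-free).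

## What (all PROVED; no definition, no named fact, no `sorry`)
* §1 `exists_h1Eval_eq_of_indepRes` — joint surjectivity of the evaluations (McCallum (2) / Gross 9.3) with exponents
  and independence of the RESTRICTIONS (`GenusExact.exists_h1Eval_eq_of_indep_of_res`, hypotheses weakened; same proof).
* §2 `exists_values_regular` — the value form of Step B: `x` with `κ_i + A(∑_j Tm i j • x_j) + x_i = α_i P + (Tm α)_i AP`.
* §3 `h1Eval_conjGalCMH_of_matrix`, `exists_h1Eval_conj_mul_eq_regular` — McCallum's Galois element `ρ₀ · n`
  realising the values (K-side; drop-in for the engine's `exists_h1Eval_conj_mul_order_regular`).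
References (locators only; no cited FACT is declared): [cite: McCallumLMS1991, §3 (2), Prop. 3.1, Cor. 3.2]
[cite: GrossLMS1991, §9 Prop. 9.3] [cite: MazurRubin2004, §2.4 (H.2), §4.1] [cite: LawsonWuthrich2016, Lemma 3].
Design: no definitions; axioms `propext`, `Classical.choice`, `Quot.sound`.
-/

set_option linter.dupNamespace false -- tree convention: `Summit.BirchSwinnertonDyer.BirchSwinnertonDyer.Theorems`
set_option autoImplicit false

noncomputable section

namespace Summit.BirchSwinnertonDyer.BirchSwinnertonDyer.Theorems.KolyvaginAtTwo.RegularValueEngine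

open scoped Classical
open WeierstrassCurve Field Finset
open Literature.NumberTheory.EllipticCurves
open Summit.BirchSwinnertonDyer.BirchSwinnertonDyer.Theorems.GenusExact

universe u v


/-! ### §1 Joint surjectivity of the evaluations, phantom-tolerant (exponents/independence of the RESTRICTIONS) -/

section JointImage

variable {K : Type u} [Field K] (W : WeierstrassCurve K)

/-- **McCallum (2) / Gross Prop. 9.3, phantom-tolerant form.** For classes `x_i ∈ H¹(K, E[n])` (`p ∣ n`) whose
RESTRICTIONS to `Γ_{K(E[n])}` are killed by `p^{eᵢ}` (`he`) and independent (`hind`: if `[∑ aᵢxᵢ, ρ] = 0` for all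
`ρ ∈ Γ_{K(E[n])}` then `p^{eᵢ} ∣ aᵢ`), and `E[p]` simple with scalar commutant: every `t ∈ ∏ E[n][p^{eᵢ}]` is
`([x_i, ρ])_i` for some `ρ ∈ Γ_{K(E[n])}`. Same proof as `GenusExact.exists_h1Eval_eq_of_indep_of_res` (whose `he`,
`hind`, `hres` about the CLASSES imply these); classes meeting the inflation kernel are allowed.
[cite: McCallumLMS1991, §3 (2)] [cite: GrossLMS1991, Prop. 9.3] [cite: LawsonWuthrich2016, Lemma 3] -/
theorem exists_h1Eval_eq_of_indepRes {p : ℕ} (hp : p.Prime) {n : ℤ} (hpn : (p : ℤ) ∣ n)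
    (hS : ∀ H : AddSubgroup (geomTorsion W p),
      (∀ g : absoluteGaloisGroup K, ∀ t ∈ H, g • t ∈ H) → H = ⊥ ∨ H = ⊤)
    (hC : ∀ f : geomTorsion W p →+ geomTorsion W p,
      (∀ (g : absoluteGaloisGroup K) (t : geomTorsion W p), f (g • t) = g • f t) →
        ∃ k : ℤ, ∀ t, f t = k • t)
    {ι : Type*} [Fintype ι] (xs : ι → galH1Torsion W n) (e : ι → ℕ)
    (he : ∀ i, ∀ ρ ∈ torsionFixing W n, ((p : ℤ) ^ e i) • h1Eval W n (xs i) ρ = 0)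
    (hind : ∀ a : ι → ℤ, (∀ ρ ∈ torsionFixing W n, h1Eval W n (∑ i, a i • xs i) ρ = 0) →
      ∀ i, ((p : ℤ) ^ e i) ∣ a i)
    (t : ι → geomTorsion W n) (ht : ∀ i, ((p : ℤ) ^ e i) • t i = 0) :
    ∃ ρ ∈ torsionFixing W n, ∀ i, h1Eval W n (xs i) ρ = t i := by
  set ι₁ : geomTorsion W p →+ geomTorsion W n :=
    AddSubgroup.inclusion (W.geomTorsion_le_of_dvd hpn) with hι₁
  have hιG : ∀ (g : absoluteGaloisGroup K) (s : geomTorsion W p), ι₁ (g • s) = g • ι₁ s :=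
    fun _ _ ↦ rfl
  have hrange : ∀ s : geomTorsion W n, (p : ℤ) • s = 0 → ∃ s₁, ι₁ s₁ = s := fun s hs ↦ by
    refine ⟨⟨(s : geomPoints W), ?_⟩, rfl⟩
    rw [mem_geomTorsion_iff]
    have := congrArg (fun x : geomTorsion W n ↦ (x : geomPoints W)) hs
    simpa using this
  have hfull := KolyvaginPairing.eq_piTors_of_stable_of_indep hp hS hC ι₁ hιG hrange
    (Finset.univ.sup e) (fun i ↦ Finset.le_sup (Finset.mem_univ i)) (jointRangeN W n xs)
    (fun g m hm ↦ smul_mem_jointRangeN W n xs g hm) (fun m hm i ↦ ?_) (fun a ha ↦ ?_)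
  · have : t ∈ jointRangeN W n xs := by rw [hfull]; exact ht
    exact this
  · obtain ⟨ρ, hρ, hm⟩ := hm
    rw [← hm i]
    exact he i ρ hρ
  · refine hind a fun ρ hρ ↦ ?_
    rw [h1Eval_sum W n _ _ hρ]
    simp only [h1Eval_zsmul W n _ _ hρ]
    exact ha _ ⟨ρ, hρ, fun i ↦ rfl⟩

end JointImage

/-! ### §2 Step B, VALUE form: prescribing `κ_i + A(∑_j T i j • x_j) + x_i` on a free rank-one `ℤ/2^M[A]`-module -/

section StepBValues

variable {T : Type*} [AddCommGroup T]

/-- Coefficients of an element of `ℤP ⊕ ℤ·AP` are determined modulo `2^M`. [folklore] -/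
theorem coeff_unique {A : T →+ T} {M : ℕ} {P : T}
    (hfree : ∀ a b : ℤ, a • P + b • A P = 0 → (2 : ℤ) ^ M ∣ a ∧ (2 : ℤ) ^ M ∣ b)
    {a b a' b' : ℤ} (h : a • P + b • A P = a' • P + b' • A P) :
    (2 : ℤ) ^ M ∣ a - a' ∧ (2 : ℤ) ^ M ∣ b - b' := by
  apply hfree
  rw [sub_smul, sub_smul, ← sub_eq_zero.mpr h]
  abel

/-- A multiple of `2^M` kills `P` (of order dividing `2^M`). [folklore] -/
theorem zsmul_eq_zero_of_dvd {M : ℕ} {P : T} (hPM : (2 : ℤ) ^ M • P = 0) {a : ℤ} (ha : (2 : ℤ) ^ M ∣ a) :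
    a • P = 0 := by
  obtain ⟨c, rfl⟩ := ha
  rw [mul_comm, mul_smul, hPM, smul_zero]

/-- **Step B, VALUE form, for a `τ`-stable span given by a matrix.** `A` an additive involution of `T`, `P` with
`2^M P = 0` and `T = ℤP ⊕ ℤ·AP` free over `ℤ/2^M` (`hgen`, `hfree` — the regular element, gk2-p3's `free_of_regular`);
a finite index set with exponents `e i`, an integer matrix `Tm i j` (the action of `τ` on the span), OFFSETS
`κ i` killed by `2^{e i}` and fixed by the twisted action `y ↦ (A (∑_j Tm i j • y j))_i` (`hκσ`; these are the
constants `[c_i, h²]`), and a CHARACTER `α : ι → ℤ` with `2^M ∣ 2^{e i} α i`. Then there is `x : ι → T` with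
`2^{e i} x i = 0` and `κ i + A (∑_j Tm i j • x j) + x i = α i • P + (∑_j Tm i j * α j) • A P` for every `i`.
Choice: write `κ i = γ i • P + δ i • AP`; fixedness gives `δ i ≡ ∑_j Tm i j γ j`; take `x i := (α i − γ i) • P`.
[cite: McCallumLMS1991, §3 (2), Prop. 3.1 (proof)] -/
theorem exists_values_regular (A : T →+ T) (hA2 : ∀ t, A (A t) = t) {M : ℕ} {P : T}
    (hPM : (2 : ℤ) ^ M • P = 0)
    (hgen : ∀ Q : T, ∃ a b : ℤ, Q = a • P + b • A P)
    (hfree : ∀ a b : ℤ, a • P + b • A P = 0 → (2 : ℤ) ^ M ∣ a ∧ (2 : ℤ) ^ M ∣ b)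
    {ι : Type*} [Fintype ι] (Tm : ι → ι → ℤ) (e : ι → ℕ)
    (κ : ι → T) (hκe : ∀ i, (2 : ℤ) ^ e i • κ i = 0)
    (hκσ : ∀ i, A (∑ j, Tm i j • κ j) = κ i)
    (α : ι → ℤ) (hα : ∀ i, (2 : ℤ) ^ M ∣ 2 ^ e i * α i) :
    ∃ x : ι → T, (∀ i, (2 : ℤ) ^ e i • x i = 0) ∧
      ∀ i, κ i + A (∑ j, Tm i j • x j) + x i = α i • P + (∑ j, Tm i j * α j) • A P := by
  have hAPM : (2 : ℤ) ^ M • A P = 0 := by rw [← map_zsmul, hPM, map_zero]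
  -- coordinates of the offsets
  choose γ δ hγδ using fun i ↦ hgen (κ i)
  -- `A` on a combination
  have hAcomb : ∀ a b : ℤ, A (a • P + b • A P) = b • P + a • A P := fun a b ↦ by
    rw [map_add, map_zsmul, map_zsmul, hA2, add_comm]
  -- a combination of combinations
  have hsum : ∀ (c a b : ι → ℤ), ∑ j, c j • (a j • P + b j • A P) =
      (∑ j, c j * a j) • P + (∑ j, c j * b j) • A P := fun c a b ↦ by
    simp_rw [smul_add, smul_smul, Finset.sum_add_distrib, Finset.sum_smul]
  -- fixedness read in coordinates: `δ i ≡ ∑_j Tm i j γ j (mod 2^M)`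
  have hδ : ∀ i, (2 : ℤ) ^ M ∣ δ i - ∑ j, Tm i j * γ j := fun i ↦ by
    have h1 : A (∑ j, Tm i j • κ j) = (∑ j, Tm i j * δ j) • P + (∑ j, Tm i j * γ j) • A P := by
      simp_rw [hγδ]
      rw [hsum, hAcomb]
    have h2 : γ i • P + δ i • A P = (∑ j, Tm i j * δ j) • P + (∑ j, Tm i j * γ j) • A P := by
      rw [← hγδ i, ← hκσ i, h1]
    exact (coeff_unique hfree h2).2
  -- `2^{e i} γ i ≡ 0`
  have hγ : ∀ i, (2 : ℤ) ^ M ∣ 2 ^ e i * γ i := fun i ↦ by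
    have h1 : (2 ^ e i * γ i) • P + (2 ^ e i * δ i) • A P = 0 := by
      rw [mul_smul, mul_smul, ← smul_add, ← hγδ i, hκe i]
    exact (hfree _ _ h1).1
  refine ⟨fun i ↦ (α i - γ i) • P, fun i ↦ ?_, fun i ↦ ?_⟩
  · rw [smul_smul, mul_sub]
    exact zsmul_eq_zero_of_dvd hPM (dvd_sub (hα i) (hγ i))
  · have h1 : ∑ j, Tm i j • ((α j - γ j) • P) = (∑ j, Tm i j * (α j - γ j)) • P := by
      simp_rw [smul_smul, Finset.sum_smul]
    have h2 : (δ i - ∑ j, Tm i j * γ j) • A P = 0 := zsmul_eq_zero_of_dvd hAPM (hδ i)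
    rw [h1, map_zsmul, hγδ i]
    have h3 : ∑ j, Tm i j * (α j - γ j) = (∑ j, Tm i j * α j) - ∑ j, Tm i j * γ j := by
      simp_rw [mul_sub, Finset.sum_sub_distrib]
    rw [h3, ← sub_eq_zero]
    rw [sub_smul] at h2
    rw [← h2]
    module

end StepBValues

/-! ### §3 McCallum's Galois element realising the VALUES (K-side; regular element `A = ρ₀⁻¹ ∘ τ`) -/

section StepBGalois

variable {k : Type v} {K : Type u} [Field k] [Field K] [Algebra k K] (W : WeierstrassCurve k)
variable {σ : K ≃ₐ[k] K} {τ : AlgebraicClosure K ≃+* AlgebraicClosure K}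

/-- **`[c_i, τ⁻¹gτ] = τ·[σ_* c_i, g] = τ·(∑_j T i j • [c_j, g])` for a span that is `τ`-stable through the matrix `T`**
(on `Γ_{K(E[n])}`): the tree's `[σ_* x, g] = τ[x, τ⁻¹ g τ]` (`IsLiftOfAut.h1Eval_conjAct`) read on the span; matrix
form of `GenusExact.h1Eval_conjGalCMH_of_tauStable`. [cite: McCallumLMS1991, Prop. 3.1 (proof)] [cite: GrossLMS1991, §9] -/
theorem h1Eval_conjGalCMH_of_matrix (hτ : IsLiftOfAut σ τ) (hinv : ∀ x, τ (τ x) = x) (n : ℤ)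
    {ι : Type*} [Fintype ι] {xs : ι → galH1Torsion (W.baseChange K) n} (Tm : ι → ι → ℤ)
    (hT : ∀ i, ∀ ρ ∈ torsionFixing (W.baseChange K) n,
      h1Eval (W.baseChange K) n (conjAct W σ n (xs i)) ρ = h1Eval (W.baseChange K) n (∑ j, Tm i j • xs j) ρ)
    {ρ : absoluteGaloisGroup K} (hρ : ρ ∈ torsionFixing (W.baseChange K) n) (i : ι) :
    h1Eval (W.baseChange K) n (xs i) (hτ.conjGalCMH ρ) =
      hτ.torsionMap W n (∑ j, Tm i j • h1Eval (W.baseChange K) n (xs j) ρ) := by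
  have h := hτ.h1Eval_conjAct W n (xs i) hρ
  rw [hT i ρ hρ, h1Eval_sum _ n _ _ hρ] at h
  simp only [h1Eval_zsmul _ n _ _ hρ] at h
  rw [h, hτ.torsionMap_torsionMap W hinv]

/-- **McCallum's Galois element at `2` for a REGULAR element, VALUE form, `τ`-stable span (phantom-tolerant).** As the
engine's `exists_h1Eval_conj_mul_order_regular` (crux 23716, §H), but: the family `xs` need only span a `τ`-STABLE
subgroup (matrix `Tm` on `Γ_{K(E[n])}`, hypothesis `hT`), exponents and independence are asked of the RESTRICTIONS
(`he`, `hind`), the regular element `A = ρ₀⁻¹ ∘ τ` is given with a free basis `(P, AP)` of `E[n][2^M]`-coefficients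
(`hgen`, `hfree`), and instead of exact orders one prescribes a CHARACTER `α` (`2^M ∣ 2^{e i} α i`). Output:
`nn ∈ Γ_{K(E[n])}` with `[x_i, (ρ₀ nn m)^τ (ρ₀ nn m)] = α i • P + (∑_j Tm i j α j) • AP` for all `m ∈ 𝒩`, all `i`.
[cite: McCallumLMS1991, §3 (2), Prop. 3.1, Cor. 3.2] [cite: GrossLMS1991, §9 Prop. 9.3] -/
theorem exists_h1Eval_conj_mul_eq_regular [W.IsElliptic] (hτ : IsLiftOfAut σ τ)
    (hinv : ∀ x, τ (τ x) = x) {n : ℤ} (h2n : (2 : ℤ) ∣ n) {M : ℕ}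
    (hS : ∀ H : AddSubgroup (geomTorsion (W.baseChange K) 2),
      (∀ g : absoluteGaloisGroup K, ∀ t ∈ H, g • t ∈ H) → H = ⊥ ∨ H = ⊤)
    (hC : ∀ f : geomTorsion (W.baseChange K) 2 →+ geomTorsion (W.baseChange K) 2,
      (∀ (g : absoluteGaloisGroup K) (t : geomTorsion (W.baseChange K) 2), f (g • t) = g • f t) →
        ∃ c : ℤ, ∀ t, f t = c • t)
    (ρ₀ : absoluteGaloisGroup K)
    (hk₀ : hτ.conjGalCMH ρ₀ * ρ₀ ∈ torsionFixing (W.baseChange K) n)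
    {P : geomTorsion (W.baseChange K) n} (hPM : (2 : ℤ) ^ M • P = 0)
    (hgen : ∀ Q : geomTorsion (W.baseChange K) n, ∃ a b : ℤ,
      Q = a • P + b • (ρ₀⁻¹ • hτ.torsionMap W n P))
    (hfree : ∀ a b : ℤ, a • P + b • (ρ₀⁻¹ • hτ.torsionMap W n P) = 0 → (2 : ℤ) ^ M ∣ a ∧ (2 : ℤ) ^ M ∣ b)
    {ι : Type*} [Fintype ι] {xs : ι → galH1Torsion (W.baseChange K) n} (Tm : ι → ι → ℤ)
    (hT : ∀ i, ∀ ρ ∈ torsionFixing (W.baseChange K) n,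
      h1Eval (W.baseChange K) n (conjAct W σ n (xs i)) ρ = h1Eval (W.baseChange K) n (∑ j, Tm i j • xs j) ρ)
    (e : ι → ℕ)
    (he : ∀ i, ∀ ρ ∈ torsionFixing (W.baseChange K) n, (2 : ℤ) ^ e i • h1Eval (W.baseChange K) n (xs i) ρ = 0)
    (hind : ∀ a : ι → ℤ, (∀ ρ ∈ torsionFixing (W.baseChange K) n,
      h1Eval (W.baseChange K) n (∑ i, a i • xs i) ρ = 0) → ∀ i, (2 : ℤ) ^ e i ∣ a i)
    (α : ι → ℤ) (hα : ∀ i, (2 : ℤ) ^ M ∣ 2 ^ e i * α i) :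
    ∃ nn ∈ torsionFixing (W.baseChange K) n, ∀ m ∈ evalKer (W.baseChange K) n xs, ∀ i,
      h1Eval (W.baseChange K) n (xs i) (hτ.conjGalCMH (ρ₀ * nn * m) * (ρ₀ * nn * m)) =
        α i • P + (∑ j, Tm i j * α j) • (ρ₀⁻¹ • hτ.torsionMap W n P) := by
  set TF := torsionFixing (W.baseChange K) n with hTF
  set k₀ := hτ.conjGalCMH ρ₀ * ρ₀ with hk₀def
  -- the involution `A = ρ₀⁻¹ ∘ τ` of `E[n]`
  have hτinv : ∀ s : geomTorsion (W.baseChange K) n,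
      hτ.torsionMap W n (ρ₀⁻¹ • s) = (hτ.conjGalCMH ρ₀)⁻¹ • hτ.torsionMap W n s := fun s ↦ by
    rw [← map_inv, ← hτ.torsionMap_smul W n, hτ.conjGalCMH_conjGalCMH hinv]
  set A : geomTorsion (W.baseChange K) n →+ geomTorsion (W.baseChange K) n :=
    { toFun := fun s ↦ ρ₀⁻¹ • hτ.torsionMap W n s
      map_zero' := by rw [map_zero, smul_zero]
      map_add' := fun s t ↦ by rw [map_add, smul_add] } with hAdef
  have hA : ∀ s, A s = ρ₀⁻¹ • hτ.torsionMap W n s := fun _ ↦ rfl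
  have hA2 : ∀ t, A (A t) = t := fun t ↦ by
    rw [hA, hA, hτinv, hτ.torsionMap_torsionMap W hinv, smul_smul, ← mul_inv_rev,
      smul_eq_of_mem_torsionFixing _ n (inv_mem hk₀)]
  -- the constants `κ i = [c_i, k₀]`
  set κ : ι → geomTorsion (W.baseChange K) n := fun i ↦ h1Eval (W.baseChange K) n (xs i) k₀ with hκdef
  have hκe : ∀ i, (2 : ℤ) ^ e i • κ i = 0 := fun i ↦ he i k₀ hk₀
  have hconjk₀ : hτ.conjGalCMH k₀ = ρ₀ * k₀ * ρ₀⁻¹ := by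
    rw [hk₀def, map_mul, hτ.conjGalCMH_conjGalCMH hinv, mul_assoc, mul_inv_cancel_right]
  have hκσ : ∀ i, A (∑ j, Tm i j • κ j) = κ i := fun i ↦ by
    have h1 : ∑ j, Tm i j • κ j = h1Eval (W.baseChange K) n (∑ j, Tm i j • xs j) k₀ := by
      rw [h1Eval_sum _ n _ _ hk₀]
      simp only [h1Eval_zsmul _ n _ _ hk₀, hκdef]
    rw [h1, ← hT i k₀ hk₀, hτ.h1Eval_conjAct W n (xs i) hk₀, hconjk₀, h1Eval_conj _ n _ ρ₀ hk₀, hA,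
      hτ.torsionMap_torsionMap W hinv, inv_smul_smul]
  -- the targets (§2) and their realisation (§1)
  obtain ⟨x, hxe, hx⟩ := exists_values_regular A hA2 hPM hgen hfree Tm e κ hκe hκσ α hα
  obtain ⟨nn, hnn, hnne⟩ := exists_h1Eval_eq_of_indepRes (W.baseChange K) Nat.prime_two h2n hS hC
    xs e he hind x hxe
  refine ⟨nn, hnn, fun m hm i ↦ ?_⟩
  have hnm : nn * m ∈ TF := mul_mem hnn hm.1
  have hconj_nm : hτ.conjGalCMH (nn * m) ∈ TF := hτ.conjGalCMH_mem_torsionFixing W hinv _ hnm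
  have hY : ρ₀⁻¹ * hτ.conjGalCMH (nn * m) * ρ₀⁻¹⁻¹ ∈ TF := (torsionFixing_normal _ n).conj_mem _ hconj_nm ρ₀⁻¹
  have hdecomp : hτ.conjGalCMH (ρ₀ * nn * m) * (ρ₀ * nn * m) =
      k₀ * ((ρ₀⁻¹ * hτ.conjGalCMH (nn * m) * ρ₀⁻¹⁻¹) * (nn * m)) := by
    rw [hk₀def, mul_assoc ρ₀ nn m, map_mul]
    group
  have hvalj : ∀ j, h1Eval (W.baseChange K) n (xs j) (nn * m) = x j := fun j ↦ by
    rw [h1Eval_mul _ _ _ hnn, hnne j, hm.2 j, add_zero]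
  have hval : h1Eval (W.baseChange K) n (xs i) (hτ.conjGalCMH (ρ₀ * nn * m) * (ρ₀ * nn * m)) =
      κ i + A (∑ j, Tm i j • x j) + x i := by
    rw [hdecomp, h1Eval_mul _ _ _ hk₀, h1Eval_mul _ _ _ hY, h1Eval_conj _ n _ ρ₀⁻¹ hconj_nm,
      h1Eval_conjGalCMH_of_matrix W hτ hinv n Tm hT hnm]
    simp only [hvalj]
    rw [hA, add_assoc]
  rw [hval]
  exact hx i

end StepBGalois

end Summit.BirchSwinnertonDyer.BirchSwinnertonDyer.Theorems.KolyvaginAtTwo.RegularValueEngine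

end
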